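import Literature.AlgebraicGeometry.HodgeTheory.FermatSurfaceEigenformsVanish
import Literature.AlgebraicGeometry.HodgeTheory.FermatSurfaceEigenformsOnModels
import HarnessLib

/-!
# Aoki–Shioda (2.1) holds: the Hodge eigenlines of the Fermat surface are algebraic

Family `hodge`, layer `Literature/AlgebraicGeometry/HodgeTheory`. PROOF FILE (theorems only; no
definition, no named fact — D-0026) DISCHARGING the named fact
`AokiShioda1983_eigenline_le_neronSeveri` (`FermatSurfaceNeronSeveriEigenlines`; Aoki–Shioda,
Progr. Math. 35 (1983), §2 (2.1): `NS(X²ₘ) ⊗ ℂ ⊇ V(α)` for every `α ∈ 𝔅²ₘ`).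

The tree had reduced the fact to Lefschetz `(1,1)` — a theorem, `lefschetzOneOne_rational_holds` —
and ONE analytic leaf (`AokiShioda1983_eigenline_le_neronSeveri_holds_of_modelEigenforms`,
`FermatSurfaceEigenformsOnModels`): on every holomorphic model `(M, ψ, Φ)` of the Fermat surface
no non-zero smooth closed `(2,0)`-form is a `χ_β`-eigenform for a Hodge character `β ∈ 𝔅²ₘ`.
In print this is Shioda's (1.7) (`V(β) ⊂ H^{2,0}` iff `|β| = 1`, while `|β| = 2` on `𝔅²ₘ`),
i.e. the description `H⁰(X²ₘ, Ω²) = {Res(x^c Ω/F)}` of the holomorphic `2`-forms by residues of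
characters of length `1`. The tree proves the leaf by a Liouville argument on the
`μₘ³`-quotient plane instead of the residue comparison (`modelEigenform_apply_eq_zero_of_generic`,
`FermatSurfaceEigenformsVanish`: the eigenform vanishes at the points of `M₀` with no vanishing
affine coordinate). This file supplies the two remaining soft steps and assembles:

* `dense_fermatModel_generic` — the points of `M₀` with no vanishing coordinate are DENSE in `M`
  (explicit perturbation `[z] ↦ [z_ε]` inside `V(Σ xᵢᵐ)` making all coordinates non-zero, the
  continuity of `[·]` and the embedding `ψ`);
* `mform_eq_zero_of_dense` — a smooth form vanishing on a dense set vanishes (continuity of the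
  chart representatives);
* `fermatSurface_modelEigenform_eq_zero` — the leaf `hmodel`, verbatim;
* `AokiShioda1983_eigenline_le_neronSeveri_holds` — **the named fact**.

## References

* [AokiShioda1983] N. Aoki, T. Shioda, Generators of the Néron–Severi group of a Fermat surface,
  Progr. Math. 35 (1983) 1–12, §2 (2.1)–(2.2).
* [Shioda1979HodgeFermat] T. Shioda, The Hodge conjecture for Fermat varieties, Math. Ann. 245
  (1979) 175–184, §1 (1.7) and Thm. I.
* [VoisinHodgeI2002] C. Voisin, Hodge Theory and Complex Algebraic Geometry I (2002), Thm. 11.30.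
-/

noncomputable section

open scoped Manifold ContDiff Topology LinearAlgebra.Projectivization
open Set Filter Projectivization Function

namespace Literature.AlgebraicGeometry.HodgeTheory

open Literature.AlgebraicGeometry.Motives Literature.NumberTheory.Transcendental
  Literature.Geometry.Kaehler Literature.Analysis.Complex

/-! ### A smooth form vanishing on a dense set vanishes -/

section Forms

variable {E : Type*} [NormedAddCommGroup E] [NormedSpace ℝ E] {M : Type*} [TopologicalSpace M]
  [ChartedSpace E M] [IsManifold 𝓘(ℝ, E) ∞ M] {F : Type*} [NormedAddCommGroup F] [NormedSpace ℝ F]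
  {k : ℕ}

/-- **A smooth form which vanishes on a dense set vanishes**: at `x₁` the chart representative
`η.inChart x₁` is continuous at the centre and vanishes on the (dense near the centre) image of
the set, so `η x₁ = η.inChart x₁ (centre) = 0`. [folklore] -/
theorem mform_eq_zero_of_dense {η : MForm 𝓘(ℝ, E) M F k} (hs : IsSmoothForm η) {S : Set M}
    (hS : Dense S) (h0 : ∀ x ∈ S, η x = 0) : η = 0 := by
  funext x₁
  set φ := extChartAt 𝓘(ℝ, E) x₁ with hφ
  set c : E := φ x₁ with hc
  set A := η.inChart x₁ with hA
  have hAc : ContinuousAt A c := by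
    have h := hs x₁
    rw [ModelWithCorners.Boundaryless.range_eq_univ] at h
    exact (h.contDiffAt univ_mem).continuousAt
  -- the representative vanishes over `S`
  set D : Set E := {y | y ∈ φ.target ∧ φ.symm y ∈ S} with hD
  have hD0 : ∀ y ∈ D, A y = 0 := by
    intro y hy
    have hy0 : η ((extChartAt 𝓘(ℝ, E) x₁).symm y) = 0 := h0 _ hy.2
    ext v
    rw [hA, MForm.inChart_apply, hy0]
    rfl
  -- the centre is in the closure of `D`
  have hcD : c ∈ closure D := by
    rw [mem_closure_iff_nhds]
    intro U hU
    have hV : φ ⁻¹' U ∩ φ.source ∈ 𝓝 x₁ :=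
      inter_mem ((continuousAt_extChartAt (I := 𝓘(ℝ, E)) x₁).preimage_mem_nhds hU)
        (extChartAt_source_mem_nhds (I := 𝓘(ℝ, E)) x₁)
    obtain ⟨x, hxS, hxU, hxsrc⟩ := hS.inter_nhds_nonempty hV
    exact ⟨φ x, hxU, φ.map_source hxsrc, by rw [φ.left_inv hxsrc]; exact hxS⟩
  have hAcl : A c ∈ closure (A '' D) := hAc.continuousWithinAt.mem_closure_image hcD
  have hsub : A '' D ⊆ {0} := by
    rintro _ ⟨y, hy, rfl⟩
    exact hD0 y hy
  have hA0 : A c = 0 := by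
    have := (closure_mono hsub) hAcl
    rwa [closure_singleton, mem_singleton_iff] at this
  rw [hA, hc, MForm.inChart_apply_self] at hA0
  exact hA0

end Forms

/-! ### The generic points of a model of the Fermat surface are dense -/

section Dense

variable {m : ℕ}

/-- **Inside `V(Σ xᵢᵐ)` every point is a limit of points with no vanishing coordinate.** For
`z ≠ 0` with `Σ z_rᵐ = 0` pick `r₀` with `z_{r₀} ≠ 0` and put, for `ε ∈ ℂ`,
`z_ε = (…, ε (where z_r = 0), …, z_{r₀}(1 − k εᵐ/z_{r₀}ᵐ)^{1/m}, …, z_r (elsewhere), …)`,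
`k = #{r | z_r = 0}`: then `Σ (z_ε)_rᵐ = 0` for all `ε`, `z_ε → z` as `ε → 0`, and all
coordinates of `z_ε` are non-zero for small `ε ≠ 0`. [cite: Shioda1979HodgeFermat, §1] -/
theorem exists_perturbation_fermatCone (hm : m ≠ 0) {z : Fin (2 + 2) → ℂ} (hz : z ≠ 0)
    (hsum : ∑ r, z r ^ m = 0) :
    ∃ w : ℂ → Fin (2 + 2) → ℂ, (∀ ε, ∑ r, w ε r ^ m = 0) ∧ (∀ ε, w ε ≠ 0) ∧
      Tendsto w (𝓝 0) (𝓝 z) ∧ ∀ᶠ ε in 𝓝[≠] (0 : ℂ), ∀ r, w ε r ≠ 0 := by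
  classical
  obtain ⟨r₀, hr₀⟩ := Function.ne_iff.mp hz
  -- a second non-zero coordinate
  have hr₁ : ∃ r₁, r₁ ≠ r₀ ∧ z r₁ ≠ 0 := by
    by_contra hcon
    push Not at hcon
    have : ∑ r, z r ^ m = z r₀ ^ m := by
      rw [Finset.sum_eq_single r₀ (fun r _ hr ↦ by rw [hcon r hr, zero_pow hm]) (by simp)]
    rw [this] at hsum
    exact hr₀ ((pow_eq_zero_iff hm).mp hsum)
  obtain ⟨r₁, hr₁₀, hr₁⟩ := hr₁
  set J : Finset (Fin (2 + 2)) := Finset.univ.filter fun r ↦ z r = 0 with hJ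
  set kJ : ℂ := (J.card : ℂ) with hkJ
  set g : ℂ → ℂ := fun ε ↦ (1 - kJ * ε ^ m / z r₀ ^ m) ^ ((m : ℂ)⁻¹) with hg
  set w : ℂ → Fin (2 + 2) → ℂ := fun ε r ↦ if r = r₀ then z r₀ * g ε else
    if z r = 0 then ε else z r with hw
  have hwr₀ : ∀ ε, w ε r₀ = z r₀ * g ε := fun ε ↦ by simp [hw]
  have hwJ : ∀ ε r, r ≠ r₀ → z r = 0 → w ε r = ε := fun ε r hr hzr ↦ by simp [hw, hr, hzr]
  have hwK : ∀ ε r, r ≠ r₀ → z r ≠ 0 → w ε r = z r := fun ε r hr hzr ↦ by simp [hw, hr, hzr]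
  have hz0m : z r₀ ^ m ≠ 0 := pow_ne_zero _ hr₀
  have hgpow : ∀ ε, (z r₀ * g ε) ^ m = z r₀ ^ m - kJ * ε ^ m := fun ε ↦ by
    rw [mul_pow, hg]
    simp only [Complex.cpow_nat_inv_pow _ hm]
    calc z r₀ ^ m * (1 - kJ * ε ^ m / z r₀ ^ m) = z r₀ ^ m - kJ * ε ^ m * (z r₀ ^ m / z r₀ ^ m) := by
          ring
      _ = z r₀ ^ m - kJ * ε ^ m := by rw [div_self hz0m, mul_one]
  -- the sums
  have hsplit : ∀ f : Fin (2 + 2) → ℂ, ∑ r, f r =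
      f r₀ + (∑ r ∈ (Finset.univ.erase r₀).filter (fun r ↦ z r = 0), f r) +
        ∑ r ∈ (Finset.univ.erase r₀).filter (fun r ↦ ¬ z r = 0), f r := by
    intro f
    rw [← Finset.add_sum_erase _ _ (Finset.mem_univ r₀), ← Finset.sum_filter_add_sum_filter_not
      _ (fun r ↦ z r = 0), add_assoc]
  have hJeq : (Finset.univ.erase r₀).filter (fun r ↦ z r = 0) = J := by
    rw [hJ, Finset.filter_erase, Finset.erase_eq_of_notMem]
    rw [Finset.mem_filter]
    exact fun h ↦ hr₀ h.2
  have hJmem : ∀ r ∈ J, r ≠ r₀ ∧ z r = 0 := fun r hr ↦ by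
    rw [hJ, Finset.mem_filter] at hr
    exact ⟨fun h ↦ hr₀ (h ▸ hr.2), hr.2⟩
  have hsumw : ∀ ε, ∑ r, w ε r ^ m = 0 := by
    intro ε
    rw [hsplit, hwr₀, hgpow, hJeq]
    have h1 : ∑ r ∈ J, w ε r ^ m = ∑ r ∈ J, ε ^ m :=
      Finset.sum_congr rfl fun r hr ↦ by rw [hwJ ε r (hJmem r hr).1 (hJmem r hr).2]
    have h1' : ∑ r ∈ J, ε ^ m = kJ * ε ^ m := by rw [Finset.sum_const, nsmul_eq_mul]
    have h2 : ∑ r ∈ (Finset.univ.erase r₀).filter (fun r ↦ ¬ z r = 0), w ε r ^ m =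
        ∑ r ∈ (Finset.univ.erase r₀).filter (fun r ↦ ¬ z r = 0), z r ^ m :=
      Finset.sum_congr rfl fun r hr ↦ by
        rw [Finset.mem_filter, Finset.mem_erase] at hr
        rw [hwK ε r hr.1.1 hr.2]
    have hJ0 : ∑ r ∈ J, z r ^ m = 0 :=
      Finset.sum_eq_zero fun r hr ↦ by rw [(hJmem r hr).2, zero_pow hm]
    have h3 := hsum
    rw [hsplit, hJeq, hJ0, add_zero] at h3
    rw [h1, h1', h2]
    linear_combination h3
  -- non-vanishing of the vector (coordinate `r₁`)
  have hw0 : ∀ ε, w ε ≠ 0 := fun ε h ↦ by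
    have := congrFun h r₁
    rw [hwK ε r₁ hr₁₀ hr₁] at this
    exact hr₁ this
  -- continuity at `ε = 0`
  have hgc : ContinuousAt g 0 := by
    have h1 : ContinuousAt (fun ε : ℂ ↦ 1 - kJ * ε ^ m / z r₀ ^ m) 0 := by fun_prop
    refine ContinuousAt.comp (g := fun x : ℂ ↦ x ^ ((m : ℂ)⁻¹)) ?_ h1
    apply continuousAt_cpow_const
    simp [zero_pow hm, Complex.one_mem_slitPlane]
  have hg0 : g 0 = 1 := by simp [hg, zero_pow hm]
  have hwc : Tendsto w (𝓝 0) (𝓝 z) := by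
    rw [tendsto_pi_nhds]
    intro r
    by_cases hr : r = r₀
    · subst hr
      simp_rw [hwr₀]
      have h := hgc.tendsto.const_mul (z r)
      rwa [hg0, mul_one] at h
    · by_cases hzr : z r = 0
      · simp_rw [hwJ _ r hr hzr, hzr]; exact tendsto_id
      · simp_rw [hwK _ r hr hzr]; exact tendsto_const_nhds
  -- all coordinates non-zero for small `ε ≠ 0`
  have hgne : ∀ᶠ ε in 𝓝 (0 : ℂ), g ε ≠ 0 := hgc.eventually_ne (by rw [hg0]; exact one_ne_zero)
  have hall : ∀ᶠ ε in 𝓝[≠] (0 : ℂ), ∀ r, w ε r ≠ 0 := by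
    filter_upwards [hgne.filter_mono nhdsWithin_le_nhds, self_mem_nhdsWithin] with ε hgε hε0 r
    by_cases hr : r = r₀
    · subst hr; rw [hwr₀]; exact mul_ne_zero hr₀ hgε
    · by_cases hzr : z r = 0
      · rw [hwJ ε r hr hzr]; exact hε0
      · rw [hwK ε r hr hzr]; exact hzr
  exact ⟨w, hsumw, hw0, hwc, hall⟩

variable {E : Type*} [NormedAddCommGroup E] [NormedSpace ℂ E]
  {M : Type*} [TopologicalSpace M] [ChartedSpace E M] {ψ : M → ℙ ℂ (Fin (2 + 2) → ℂ)}

omit [ChartedSpace E M] in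
/-- **The points of `M₀` with no vanishing affine coordinate are dense in `M`** for a model `ψ`
of the Fermat surface (an embedding onto `V(Σ xᵢᵐ)`): `ψ x₁ = [z]` is the limit of `[z_ε]`
(`exists_perturbation_fermatCone`, continuity of `[·]`), the `[z_ε]` are images of generic points,
and `ψ` is an embedding. [cite: Shioda1979HodgeFermat, §1] -/
theorem dense_fermatModel_generic [NeZero m] (hψ : Topology.IsEmbedding ψ)
    (hrange : Set.range ψ = projZeroLocus {fermatPolynomial ℂ 2 m}) :
    Dense {x : M | x ∈ liftDomain ψ 0 ∧ ∀ r, projLift ψ 0 x r ≠ 0} := by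
  have hm : m ≠ 0 := NeZero.ne m
  intro x₁
  set z := (ψ x₁).rep with hz
  have hz0 : z ≠ 0 := Projectivization.rep_nonzero _
  have hzsum : ∑ r, z r ^ m = 0 := by
    have hmem : ψ x₁ ∈ projZeroLocus {fermatPolynomial ℂ 2 m} := hrange ▸ ⟨x₁, rfl⟩
    have := eval_rep_eq_zero_of_mem_projZeroLocus hmem
    simpa [fermatPolynomial, map_sum] using this
  obtain ⟨w, hwsum, hw0, hwc, hall⟩ := exists_perturbation_fermatCone hm hz0 hzsum
  -- points over `[w ε]`
  have hpt : ∀ ε, ∃ x, ψ x = Projectivization.mk ℂ (w ε) (hw0 ε) := by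
    intro ε
    have hmem : Projectivization.mk ℂ (w ε) (hw0 ε) ∈ projZeroLocus {fermatPolynomial ℂ 2 m} := by
      rw [mk_mem_projZeroLocus_singleton_iff (isHomogeneous_fermatPolynomial 2 m)]
      simpa [fermatPolynomial, map_sum] using hwsum ε
    rw [← hrange] at hmem
    obtain ⟨x, hx⟩ := hmem
    exact ⟨x, hx⟩
  choose xε hxε using hpt
  -- `ψ (xε ε) → ψ x₁`, hence `xε ε → x₁`
  have hψt : Tendsto (fun ε ↦ ψ (xε ε)) (𝓝[≠] 0) (𝓝 (ψ x₁)) := by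
    have h1 : Tendsto (fun ε ↦ (⟨w ε, hw0 ε⟩ : {v : Fin (2 + 2) → ℂ // v ≠ 0})) (𝓝[≠] (0 : ℂ))
        (𝓝 ⟨z, hz0⟩) := by
      rw [tendsto_subtype_rng]
      exact hwc.mono_left nhdsWithin_le_nhds
    have h2 := ((Projectivization.continuous_mk' (𝕜 := ℂ)).tendsto _).comp h1
    have h3 : Projectivization.mk' ℂ (⟨z, hz0⟩ : {v : Fin (2 + 2) → ℂ // v ≠ 0}) = ψ x₁ := by
      rw [Projectivization.mk'_eq_mk]
      exact Projectivization.mk_rep (ψ x₁)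
    rw [h3] at h2
    refine h2.congr fun ε ↦ ?_
    rw [Function.comp_apply, Projectivization.mk'_eq_mk, hxε]
  have hxt : Tendsto xε (𝓝[≠] 0) (𝓝 x₁) := (hψ.tendsto_nhds_iff).mpr hψt
  refine mem_closure_of_tendsto hxt (hall.mono fun ε hε ↦ ?_)
  have hv : ((w ε 0)⁻¹ • w ε : Fin (2 + 2) → ℂ) ≠ 0 := smul_ne_zero (inv_ne_zero (hε 0)) (hw0 ε)
  have hmk : Projectivization.mk ℂ ((w ε 0)⁻¹ • w ε) hv = ψ (xε ε) := by
    rw [hxε ε]; exact (Projectivization.mk_eq_mk_iff' ℂ _ _ hv (hw0 ε)).mpr ⟨(w ε 0)⁻¹, rfl⟩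
  have hgen := projLift_eq_of_mk_eq ψ (i := 0) hv hmk
    (by rw [Pi.smul_apply, smul_eq_mul, inv_mul_cancel₀ (hε 0)])
  refine ⟨hgen.1, fun r ↦ ?_⟩
  rw [hgen.2, Pi.smul_apply, smul_eq_mul]
  exact mul_ne_zero (inv_ne_zero (hε 0)) (hε r)

end Dense

/-! ### The analytic leaf and the named fact -/

/-- **The analytic leaf `hmodel` of `AokiShioda1983_eigenline_le_neronSeveri_holds_of_modelEigenforms`:
on a holomorphic model `(M, ψ, Φ)` of the Fermat surface no non-zero smooth closed `(2,0)`-form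
is a `χ_β`-eigenform, `β ∈ 𝔅²ₘ`.** It vanishes at the generic points of `M₀`
(`modelEigenform_apply_eq_zero_of_generic`), which are dense (`dense_fermatModel_generic`), hence
everywhere (`mform_eq_zero_of_dense`). In print: Shioda (1.7), the holomorphic `2`-forms of
`X²ₘ` carry only characters of length `1`. [cite: Shioda1979HodgeFermat, §1 (1.7)]
[cite: AokiShioda1983, §2 (2.1)–(2.2)] -/
theorem fermatSurface_modelEigenform_eq_zero (m : ℕ) [NeZero m] (E : Type*) [NormedAddCommGroup E]
    [NormedSpace ℂ E] [FiniteDimensional ℂ E] (M : Type*) [TopologicalSpace M] [ChartedSpace E M]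
    [IsManifold 𝓘(ℂ, E) ω M] [IsManifold 𝓘(ℝ, E) ∞ M] (h2 : Module.finrank ℂ E = 2)
    (ψ : M → ℙ ℂ (Fin (2 + 2) → ℂ)) (hψ : Topology.IsEmbedding ψ)
    (hrange : Set.range ψ = projZeroLocus {fermatPolynomial ℂ 2 m}) (hhol : HasHolomorphicCoords E ψ)
    (Φ : fermatGroup 2 m → M → M) (hΦd : ∀ a, MDifferentiable 𝓘(ℂ, E) 𝓘(ℂ, E) (Φ a))
    (hΦψ : ∀ (a : fermatGroup 2 m) (x : M), ψ (Φ a x) =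
      Projectivization.mk ℂ ((a : Fin (2 + 2) → ℂˣ) • (ψ x).rep)
        ((smul_ne_zero_iff_ne (a : Fin (2 + 2) → ℂˣ)).mpr (Projectivization.rep_nonzero _)))
    (β : Fin 4 → ZMod m) (hβ : FermatCharacter.IsHodge β) (η : MForm 𝓘(ℝ, E) M ℂ 2)
    (hs : IsSmoothForm η) (hc : IsClosedForm η) (ht : IsOfType 2 0 η)
    (heig : ∀ a : fermatGroup 2 m,
      η.pullback 𝓘(ℝ, E) (Φ a) = ((fermatCharacter m β a : ℂˣ) : ℂ) • η) :
    η = 0 :=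
  mform_eq_zero_of_dense hs (dense_fermatModel_generic hψ hrange) fun _ hx ↦
    modelEigenform_apply_eq_zero_of_generic hΦψ h2 hψ hrange hhol hΦd hβ hs hc ht heig hx.1 hx.2

/-- **Aoki–Shioda 1983, (2.1): every Hodge eigenline `V(α)`, `α ∈ 𝔅²ₘ`, of the Fermat surface
`X²ₘ ⊂ ℙ³` lies in `NS(X²ₘ) ⊗ ℂ` — discharge of the named fact
`AokiShioda1983_eigenline_le_neronSeveri`.** Lefschetz `(1,1)` (`lefschetzOneOne_rational_holds`)
and the vanishing of the `(2,0)`-parts of the Hodge eigenlines, the latter through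
`AokiShioda1983_eigenline_le_neronSeveri_holds_of_modelEigenforms` and the analytic leaf
`fermatSurface_modelEigenform_eq_zero` (Shioda (1.7): no `χ_β`-eigen holomorphic `2`-form for
`|β| = 2`). Relies on: nothing unproved.
[cite: AokiShioda1983, §2 (2.1)–(2.2), p. 3] [cite: Shioda1979HodgeFermat, §1 (1.7) and Thm. I]
[cite: VoisinHodgeI2002, Thm. 11.30] -/
theorem AokiShioda1983_eigenline_le_neronSeveri_holds : AokiShioda1983_eigenline_le_neronSeveri :=
  AokiShioda1983_eigenline_le_neronSeveri_holds_of_modelEigenforms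
    fun m _ E _ _ _ M _ _ _ _ _ _ _ h2 ψ hψ hrange hhol Φ hΦd hΦψ β hβ η hs hc ht heig ↦
      fermatSurface_modelEigenform_eq_zero m E M h2 ψ hψ hrange hhol Φ hΦd hΦψ β hβ η hs hc ht heig

end Literature.AlgebraicGeometry.HodgeTheory

end
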